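import Summits.AnomalousDissipation.AnomalousDissipation.Theorems.SolenoidalFractalHomogenisationLagrangianStepOneLevelSplitApi
import Summits.AnomalousDissipation.AnomalousDissipation.Theorems.SolenoidalFractalHomogenisationLagrangianStepCellClauseCutsW
import Summits.AnomalousDissipation.AnomalousDissipation.Theorems.SolenoidalFractalHomogenisationLagrangianStepCellClauseCutsFamily
import Summits.AnomalousDissipation.AnomalousDissipation.Theorems.SolenoidalFractalHomogenisationLagrangianStepOneLevelGlueLowerFamily
import Summits.AnomalousDissipation.AnomalousDissipation.Theorems.SolenoidalFractalHomogenisationLagrangianStepWindowLedgerAbs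
import Literature.Analysis.FluidPDE.PassiveVectorTensorPropagator -- LANDER: = the S0′ taker's (ad-k3l-bookkeeping-p1 g4) Literature home of `Torus.IsPropagator`; fix the module name
import HarnessLib

/-!
# K1L_D `LagrangianRenormalisationStepDesign` (stmt-AnomalousDissipation-27980), stub `stub_oneLevelL_IW` v3: the GLUE of the one-level split
# (helper; `--supports stmt-AnomalousDissipation-27980 --as helper`; tenure D24-8 (b))

`oneLevelL_IW_of_pieces : S0′-text → S23′-text → S3d′-text → (the v2′ registered text of stub_oneLevelL_IW, VERBATIM)`, sorry-free, over the abstract energy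
ledger `window_ledger_abs` (p645039, sequel of the keystone `window_ledger` p644546).  The three binder types are the consented stub texts S0′
`stub_windowPropagatorL`, S23′ `stub_windowDefectL`, S3d′ `stub_fastContentL` of the reference file
`Summits/AnomalousDissipation/AnomalousDissipation/Cruxes/LagrangianRenormalisationStep/OneLevelSplitSketch.lean` (planner ad-ideate-p4 g11; lead consent
2026-08-28T15:52:03Z; tenure D24-7/D24-8), stated over the shared data definitions `V2 datumLp grid cutLp vSeq uSeq` (`…LagrangianStepOneLevelSplitDefs`) and
the Literature propagator spec `Torus.IsPropagator` (S0′ taker ad-k3l-bookkeeping-p1 g4).  Registry v3 then PROVES `stub_oneLevelL_IW` as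
`oneLevelL_IW_of_pieces stub_windowPropagatorL stub_windowDefectL stub_fastContentL` with the three stubs sorried byte-for-byte (tenure D24-8 (ii)).

PROOF (real-variable, ≈ 150 lines): merge the two constant packages of S23′/S3d′ (`min ν`, `max K`, `max Λ₀`, `min θ₀`; robust `≤`-forms inside the stubs),
take `m⋆ := max`; for `m ≥ m⋆` get the two propagators `U^m`, `U^{m+1}` from S0′ (tensors `NearIso (kbar·lo) (kbar·hi)` by `nearIso_renormStep` +
`NearIso.smul`); represent `u t`, `v t` for a.e. `t ∈ (1/2,1)` through `repr` at `s = 0`; feed `window_ledger_abs` on the grid of `t` with `T_j := U^m(w_j,w_{j+1})`,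
`K := ⌊t/refresh⌋₊ + 1` (`grid K = t`), `γ_j := ‖g_j‖`; add the fast content (S3d′); close with `C₁ρ^σ₁ := (3Cη + 12Cg + Cφ)·ρ^{min ση σg σφ}` (`ρ ≤ 1` by `N_m² ≤ N_{m+1}`).
Elementary facts on `grid` / norms / the cut: `…LagrangianStepOneLevelSplitApi` (namespace `OneLevelSplit`).  WHAT THIS IS NOT: not a proof of any of the three stubs, of the crux K1L_D, of Onsager's
conjecture or of anomalous dissipation; rung F-D1.A0 infrastructure.  Text by planner seat `ad-ideate-p4` g11 (2026-08-28); landed by a prover seat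
(Summits/Theorems is prover-only, D-0016).
-/

set_option linter.dupNamespace false

namespace Summit.AnomalousDissipation.AnomalousDissipation.Theorems.SolenoidalFractalHomogenisation.LagrangianStep

open Literature.Analysis Literature.Analysis.FluidPDE Literature.Analysis.FunctionSpaces
open MeasureTheory Set Filter ContinuousLinearMap
open scoped ENNReal NNReal InnerProductSpace
open Summit.AnomalousDissipation.AnomalousDissipation.Theorems.SolenoidalFractalHomogenisation.RealisedQuasiStaticCellLaw
  (memLp_two_of_memSobolev_one_complexify)

noncomputable section


open OneLevelSplit

/-! ## §2 The composition `oneLevelL_IW_of_pieces : S0′-text → S23′-text → S3d′-text → (v2′ text of `stub_oneLevelL_IW`, VERBATIM)` -/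

/-- **The composition of the v3 cut**: the S0′ text (window propagator) → the S23′ text (per-window defect decomposition) → the S3d′ text
(fast content) → the v2′ registry text of `stub_oneLevelL_IW`, VERBATIM (planner ad-ideate-p4 g11; proof over `window_ledger_abs` by name). -/
theorem oneLevelL_IW_of_pieces :
    (∀ k (E : LatticeShear.LagrangianLatticeCarrier k), E.LPermissible → E.Regular →
    ∀ (m : ℕ) (𝔸 : Torus.Visc4 (Fin 3)) (lo hi : ℝ), 0 < lo → Torus.NearIso 𝔸 lo hi →
      ∃ U : ℝ → ℝ → (V2 →L[ℝ] V2), Torus.IsPropagator 1 (E.partialSum m) 𝔸 U) →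
    (∀ k (W : Literature.Analysis.FluidPDE.LatticeShear.LatticeWord k) (M : ℝ) (hM : 0 < M) (c : ℝ), 0 < c →
    ∀ (Φ : ℝ → Torus.Visc4 (Fin 3) → Torus.Visc4 (Fin 3)) (lo hi Λ β σ C ν₀ K Cf νf Kf : ℝ),
      0 < lo → lo ≤ 1 → 1 ≤ hi → 1 < Λ → 0 ≤ β →
      0 < σ → 0 ≤ C → 0 < ν₀ → 0 < K → SlowVectorClauseF W M hM c Φ lo hi Λ β σ C ν₀ K →
      0 ≤ Cf → 0 < νf → 0 < Kf → CellEnergyClausesW W M hM c lo hi Λ β Cf νf Kf →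
      ∃ ν₁ > (0:ℝ), ∃ K₁ > (0:ℝ), ∃ Λ₀ : ℕ, ∃ θ₀ > (0:ℝ), ∃ Cη > (0:ℝ), ∃ ση > (0:ℝ), ∃ Cg > (0:ℝ), ∃ σg > (0:ℝ),
        ∀ E : Literature.Analysis.FluidPDE.LatticeShear.LagrangianLatticeCarrier k, E.design = W.stretch M hM → E.gain = c → E.nu0 ≤ ν₁ → K₁ ≤ E.K →
          E.LPermissible → E.Regular → (∀ m, Λ₀ * E.N m ≤ E.N (m + 1)) → (∀ m, E.N m ^ 2 ≤ E.N (m + 1)) →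
          (∀ m, E.cellVisc (m + 1) * ((E.N (m + 1) : ℝ) / E.N m) ^ (1 / 4 : ℝ) ≤ 1) →
          (∀ m, E.K * ((E.N (m + 1) : ℝ) / E.N m) ^ (1 / 4 : ℝ) ≤ ((E.N (m + 1) : ℝ) / E.N m) * E.cellVisc (m + 1)) →
          (∀ m, E.θ (m + 1) * ((E.N (m + 1) : ℝ) / E.N m) ^ (1 / 16 : ℝ) ≤ θ₀) →
          (∀ m, ((E.N (m + 1) : ℝ) / E.N m) ^ (1 / 16 : ℝ) * E.physPeriod (m + 1) ≤ E.refresh (m + 1)) →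
        ∀ R : ℝ≥0, ∃ mstar : ℕ, ∀ m, mstar ≤ m →
          Cη * ((E.N m : ℝ) / E.N (m + 1)) ^ ση ≤ 1 / 8 ∧
          ∀ S : Torus.Visc4 (Fin 3), Torus.OddSmall S β → Torus.NearIso S lo hi →
            Torus.OddSmall (Φ (E.cellVisc (m + 1)) S) β → Torus.NearIso (Φ (E.cellVisc (m + 1)) S) lo hi →
          ∀ (w₀ : VF) (hw₀ : IsDatum w₀), InClass R w₀ →
          ∀ Um Um1 : ℝ → ℝ → (V2 →L[ℝ] V2),
            Torus.IsPropagator 1 (E.partialSum m) (E.kbar m • renormStep (Φ (E.cellVisc (m + 1))) (E.gain / E.cellVisc (m + 1) ^ 2) S) Um →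
            Torus.IsPropagator 1 (E.partialSum (m + 1)) (E.kbar (m + 1) • S) Um1 →
          ∀ t ∈ Ioo (1/2 : ℝ) 1,
            ∃ (e g : ℕ → V2) (G : ℝ),
              (∀ j, uSeq Um1 (datumLp w₀ hw₀) (E.N (m + 1) / 2) (E.refresh (m + 1)) t (j + 1) =
                  Um (grid (E.refresh (m + 1)) t j) (grid (E.refresh (m + 1)) t (j + 1))
                    (uSeq Um1 (datumLp w₀ hw₀) (E.N (m + 1) / 2) (E.refresh (m + 1)) t j) + e j + g j) ∧
              (∀ j (y : V2), |⟪y, e j⟫_ℝ| ≤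
                  (Cη * ((E.N m : ℝ) / E.N (m + 1)) ^ ση) *
                    Real.sqrt (‖uSeq Um1 (datumLp w₀ hw₀) (E.N (m + 1) / 2) (E.refresh (m + 1)) t j‖ ^ 2 -
                      ‖Um (grid (E.refresh (m + 1)) t j) (grid (E.refresh (m + 1)) t (j + 1))
                        (uSeq Um1 (datumLp w₀ hw₀) (E.N (m + 1) / 2) (E.refresh (m + 1)) t j)‖ ^ 2) *
                    Real.sqrt (‖y‖ ^ 2 -
                      ‖ContinuousLinearMap.adjoint (Um (grid (E.refresh (m + 1)) t j) (grid (E.refresh (m + 1)) t (j + 1))) y‖ ^ 2)) ∧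
              0 ≤ G ∧ (∀ K', ∑ j ∈ Finset.range K', ‖g j‖ ≤ G) ∧ G ≤ ‖datumLp w₀ hw₀‖ ∧
              ‖datumLp w₀ hw₀‖ * G ≤
                Cg * ((E.N m : ℝ) / E.N (m + 1)) ^ σg * (‖datumLp w₀ hw₀‖ ^ 2 - ‖Um 0 t (datumLp w₀ hw₀)‖ ^ 2)) →
    (∀ k (W : Literature.Analysis.FluidPDE.LatticeShear.LatticeWord k) (M : ℝ) (hM : 0 < M) (c : ℝ), 0 < c →
    ∀ (Φ : ℝ → Torus.Visc4 (Fin 3) → Torus.Visc4 (Fin 3)) (lo hi Λ β σ C ν₀ K Cf νf Kf : ℝ),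
      0 < lo → lo ≤ 1 → 1 ≤ hi → 1 < Λ → 0 ≤ β →
      0 < σ → 0 ≤ C → 0 < ν₀ → 0 < K → SlowVectorClauseF W M hM c Φ lo hi Λ β σ C ν₀ K →
      0 ≤ Cf → 0 < νf → 0 < Kf → CellEnergyClausesW W M hM c lo hi Λ β Cf νf Kf →
      ∃ ν₁ > (0:ℝ), ∃ K₁ > (0:ℝ), ∃ Λ₀ : ℕ, ∃ θ₀ > (0:ℝ), ∃ Cφ > (0:ℝ), ∃ σφ > (0:ℝ),
        ∀ E : Literature.Analysis.FluidPDE.LatticeShear.LagrangianLatticeCarrier k, E.design = W.stretch M hM → E.gain = c → E.nu0 ≤ ν₁ → K₁ ≤ E.K →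
          E.LPermissible → E.Regular → (∀ m, Λ₀ * E.N m ≤ E.N (m + 1)) → (∀ m, E.N m ^ 2 ≤ E.N (m + 1)) →
          (∀ m, E.cellVisc (m + 1) * ((E.N (m + 1) : ℝ) / E.N m) ^ (1 / 4 : ℝ) ≤ 1) →
          (∀ m, E.K * ((E.N (m + 1) : ℝ) / E.N m) ^ (1 / 4 : ℝ) ≤ ((E.N (m + 1) : ℝ) / E.N m) * E.cellVisc (m + 1)) →
          (∀ m, E.θ (m + 1) * ((E.N (m + 1) : ℝ) / E.N m) ^ (1 / 16 : ℝ) ≤ θ₀) →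
          (∀ m, ((E.N (m + 1) : ℝ) / E.N m) ^ (1 / 16 : ℝ) * E.physPeriod (m + 1) ≤ E.refresh (m + 1)) →
        ∀ R : ℝ≥0, ∃ mstar : ℕ, ∀ m, mstar ≤ m →
          ∀ S : Torus.Visc4 (Fin 3), Torus.OddSmall S β → Torus.NearIso S lo hi →
            Torus.OddSmall (Φ (E.cellVisc (m + 1)) S) β → Torus.NearIso (Φ (E.cellVisc (m + 1)) S) lo hi →
          ∀ (w₀ : VF) (hw₀ : IsDatum w₀), InClass R w₀ →
          ∀ Um Um1 : ℝ → ℝ → (V2 →L[ℝ] V2),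
            Torus.IsPropagator 1 (E.partialSum m) (E.kbar m • renormStep (Φ (E.cellVisc (m + 1))) (E.gain / E.cellVisc (m + 1) ^ 2) S) Um →
            Torus.IsPropagator 1 (E.partialSum (m + 1)) (E.kbar (m + 1) • S) Um1 →
          ∀ t ∈ Ioo (1/2 : ℝ) 1,
            ‖Um1 0 t (datumLp w₀ hw₀)‖ ^ 2 ≤
              ‖cutLp (E.N (m + 1) / 2) (Um1 0 t (datumLp w₀ hw₀))‖ ^ 2 +
                Cφ * ((E.N m : ℝ) / E.N (m + 1)) ^ σφ * (‖datumLp w₀ hw₀‖ ^ 2 - ‖Um 0 t (datumLp w₀ hw₀)‖ ^ 2)) →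
    ∀ k (W : Literature.Analysis.FluidPDE.LatticeShear.LatticeWord k) (M : ℝ) (hM : 0 < M) (c : ℝ), 0 < c →
    ∀ (Φ : ℝ → Torus.Visc4 (Fin 3) → Torus.Visc4 (Fin 3)) (lo hi Λ β σ C ν₀ K Cf νf Kf : ℝ),
      0 < lo → lo ≤ 1 → 1 ≤ hi → 1 < Λ → 0 ≤ β →
      0 < σ → 0 ≤ C → 0 < ν₀ → 0 < K → SlowVectorClauseF W M hM c Φ lo hi Λ β σ C ν₀ K →
      0 ≤ Cf → 0 < νf → 0 < Kf → CellEnergyClausesW W M hM c lo hi Λ β Cf νf Kf →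
      ∃ ν₁ > (0:ℝ), ∃ K₁ > (0:ℝ), ∃ Λ₀ : ℕ, ∃ θ₀ > (0:ℝ), ∃ C₁ > (0:ℝ), ∃ σ₁ > (0:ℝ),
        ∀ E : Literature.Analysis.FluidPDE.LatticeShear.LagrangianLatticeCarrier k, E.design = W.stretch M hM → E.gain = c → E.nu0 = ν₁ → E.K = K₁ → E.LPermissible → E.Regular → (∀ m, Λ₀ * E.N m ≤ E.N (m + 1)) → (∀ m, E.N m ^ 2 ≤ E.N (m + 1)) → (∀ m, E.cellVisc (m + 1) * ((E.N (m + 1) : ℝ) / E.N m) ^ (1 / 4 : ℝ) ≤ 1) → (∀ m, E.K * ((E.N (m + 1) : ℝ) / E.N m) ^ (1 / 4 : ℝ) ≤ ((E.N (m + 1) : ℝ) / E.N m) * E.cellVisc (m + 1)) → (∀ m, E.θ (m + 1) * ((E.N (m + 1) : ℝ) / E.N m) ^ (1 / 16 : ℝ) ≤ θ₀) → (∀ m, ((E.N (m + 1) : ℝ) / E.N m) ^ (1 / 16 : ℝ) * E.physPeriod (m + 1) ≤ E.refresh (m + 1)) →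
        ∀ R : ℝ≥0, ∃ mstar : ℕ, ∀ m, mstar ≤ m →
          ∀ S : Torus.Visc4 (Fin 3), Torus.OddSmall S β → Torus.NearIso S lo hi →
            Torus.OddSmall (Φ (E.cellVisc (m + 1)) S) β → Torus.NearIso (Φ (E.cellVisc (m + 1)) S) lo hi →
          ∀ (w₀ : VF), IsDatum w₀ → InClass R w₀ →
          ∀ u v : ℝ → VF, TSol E (m + 1) (E.kbar (m + 1) • S) w₀ u →
            TSol E m (E.kbar m • renormStep (Φ (E.cellVisc (m + 1))) (E.gain / E.cellVisc (m + 1) ^ 2) S) w₀ v →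
            ∀ᵐ t ∂(volume.restrict (Ioo (1/2 : ℝ) 1)),
              (1 - C₁ * ((E.N m : ℝ) / E.N (m + 1)) ^ σ₁) * drop w₀ v t ≤ drop w₀ u t := by
  intro hS0 hS23 hS3d k W M hM c hc Φ lo hi Λ β σ C ν₀ K Cf νf Kf hlo hlo1 hhi hΛ hβ hσ hC hν₀ hK hV hCf hνf hKf hF
  obtain ⟨ν₁, hν₁, K₁, hK₁, Λ₀, θ₀, hθ₀, Cη, hCη, ση, hση, Cg, hCg, σg, hσg, hD⟩ :=
    hS23 k W M hM c hc Φ lo hi Λ β σ C ν₀ K Cf νf Kf hlo hlo1 hhi hΛ hβ hσ hC hν₀ hK hV hCf hνf hKf hF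
  obtain ⟨ν₂, hν₂, K₂, hK₂, Λ₂, θ₂, hθ₂, Cφ, hCφ, σφ, hσφ, hFast⟩ :=
    hS3d k W M hM c hc Φ lo hi Λ β σ C ν₀ K Cf νf Kf hlo hlo1 hhi hΛ hβ hσ hC hν₀ hK hV hCf hνf hKf hF
  refine ⟨min ν₁ ν₂, lt_min hν₁ hν₂, max K₁ K₂, lt_max_of_lt_left hK₁, max Λ₀ Λ₂, min θ₀ θ₂, lt_min hθ₀ hθ₂,
    3 * Cη + 12 * Cg + Cφ, by positivity, min ση (min σg σφ), lt_min hση (lt_min hσg hσφ), ?_⟩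
  intro E hdes hgain hnu0 hKE hLP hReg hT2 hN2 hT3a hT3b hT4 hT5 R
  have hT2₁ : ∀ m, Λ₀ * E.N m ≤ E.N (m + 1) := fun m => (Nat.mul_le_mul_right _ (le_max_left _ _)).trans (hT2 m)
  have hT2₂ : ∀ m, Λ₂ * E.N m ≤ E.N (m + 1) := fun m => (Nat.mul_le_mul_right _ (le_max_right _ _)).trans (hT2 m)
  have hT4₁ : ∀ m, E.θ (m + 1) * ((E.N (m + 1) : ℝ) / E.N m) ^ (1 / 16 : ℝ) ≤ θ₀ := fun m => (hT4 m).trans (min_le_left _ _)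
  have hT4₂ : ∀ m, E.θ (m + 1) * ((E.N (m + 1) : ℝ) / E.N m) ^ (1 / 16 : ℝ) ≤ θ₂ := fun m => (hT4 m).trans (min_le_right _ _)
  have hnu₁ : E.nu0 ≤ ν₁ := hnu0.le.trans (min_le_left _ _)
  have hnu₂ : E.nu0 ≤ ν₂ := hnu0.le.trans (min_le_right _ _)
  have hK₁E : K₁ ≤ E.K := (le_max_left _ _).trans hKE.symm.le
  have hK₂E : K₂ ≤ E.K := (le_max_right _ _).trans hKE.symm.le
  obtain ⟨m₁, hm₁⟩ := hD E hdes hgain hnu₁ hK₁E hLP hReg hT2₁ hN2 hT3a hT3b hT4₁ hT5 R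
  obtain ⟨m₂, hm₂⟩ := hFast E hdes hgain hnu₂ hK₂E hLP hReg hT2₂ hN2 hT3a hT3b hT4₂ hT5 R
  refine ⟨max m₁ m₂, fun m hm S hS₁ hS₂ hS₃ hS₄ w₀ hw₀ hR u v hu hv => ?_⟩
  obtain ⟨hη8, hDm⟩ := hm₁ m ((le_max_left _ _).trans hm)
  have hFm := hm₂ m ((le_max_right _ _).trans hm)
  -- the two propagators from S0′
  have hgain0 : 0 ≤ E.gain := hgain ▸ hc.le
  have h𝔸v : Torus.NearIso (E.kbar m • renormStep (Φ (E.cellVisc (m + 1))) (E.gain / E.cellVisc (m + 1) ^ 2) S)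
      (E.kbar m * lo) (E.kbar m * hi) :=
    (nearIso_renormStep (div_nonneg hgain0 (sq_nonneg _)) hS₂ hS₄).smul (E.kbar_pos m).le
  have h𝔸u : Torus.NearIso (E.kbar (m + 1) • S) (E.kbar (m + 1) * lo) (E.kbar (m + 1) * hi) :=
    hS₂.smul (E.kbar_pos (m + 1)).le
  obtain ⟨Um, hUm⟩ := hS0 k E hLP hReg m _ _ _ (mul_pos (E.kbar_pos m) hlo) h𝔸v
  obtain ⟨Um1, hUm1⟩ := hS0 k E hLP hReg (m + 1) _ _ _ (mul_pos (E.kbar_pos (m + 1)) hlo) h𝔸u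
  -- a.e. representation of `u t` and `v t` through the propagators
  have hw₀2 : MemLp w₀ 2 volume := memLp_two_of_memSobolev_one_complexify hw₀.1
  have hrepu := hUm1.repr 0 le_rfl zero_lt_one w₀ hw₀2 hw₀.2.2 u (by simpa only [TSol, sub_zero, zero_add] using hu)
  have hrepv := hUm.repr 0 le_rfl zero_lt_one w₀ hw₀2 hw₀.2.2 v (by simpa only [TSol, sub_zero, zero_add] using hv)
  have hsub : Ioo (1/2 : ℝ) 1 ⊆ Ioo 0 (1 - 0) := by
    rw [sub_zero]; exact Ioo_subset_Ioo (by norm_num) le_rfl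
  filter_upwards [ae_restrict_of_ae_restrict_of_subset hsub hrepu, ae_restrict_of_ae_restrict_of_subset hsub hrepv,
    ae_restrict_mem measurableSet_Ioo] with t hu1 hv1 ht
  obtain ⟨hut, hute⟩ := hu1
  obtain ⟨hvt, hvte⟩ := hv1
  rw [zero_add] at hute hvte
  have ht0 : 0 ≤ t := by linarith [ht.1]
  have ht1 : t ≤ 1 := ht.2.le
  have hr : 0 < E.refresh (m + 1) := E.refresh_pos (m + 1)
  -- energies through the propagators
  have hEu : ∫ x, ‖u t x‖ ^ 2 = ‖Um1 0 t (datumLp w₀ hw₀)‖ ^ 2 := by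
    rw [← norm_toLp_sq hut, hute]; rfl
  have hEv : ∫ x, ‖v t x‖ ^ 2 = ‖Um 0 t (datumLp w₀ hw₀)‖ ^ 2 := by
    rw [← norm_toLp_sq hvt, hvte]; rfl
  have hE0 : Torus.vectorL2Sq w₀ = ‖datumLp w₀ hw₀‖ ^ 2 := by
    rw [datumLp, norm_toLp_sq]; rfl
  -- the per-window decomposition (S23′) and the fast content (S3d′)
  obtain ⟨e, g, G, hdec, hDD, hG0, hGsum, hGle, hGpay⟩ := hDm S hS₁ hS₂ hS₃ hS₄ w₀ hw₀ hR Um Um1 hUm hUm1 t ht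
  have hfast := hFm S hS₁ hS₂ hS₃ hS₄ w₀ hw₀ hR Um Um1 hUm hUm1 t ht
  -- the ledger on the grid of `t`
  set ρ : ℝ := (E.N m : ℝ) / E.N (m + 1) with hρ_def
  have hρ0 : 0 ≤ ρ := rho_nonneg _ _
  have hρ1 : ρ ≤ 1 := rho_le_one (hN2 m)
  have hη0 : 0 ≤ Cη * ρ ^ ση := mul_nonneg hCη.le (Real.rpow_nonneg hρ0 _)
  have hvs : ∀ j, vSeq Um (datumLp w₀ hw₀) (E.refresh (m + 1)) t (j + 1) =
      Um (grid (E.refresh (m + 1)) t j) (grid (E.refresh (m + 1)) t (j + 1)) (vSeq Um (datumLp w₀ hw₀) (E.refresh (m + 1)) t j) := by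
    intro j
    cases j with
    | zero =>
      show Um 0 (grid (E.refresh (m + 1)) t (0 + 1)) (datumLp w₀ hw₀) = Um (grid (E.refresh (m + 1)) t 0) (grid (E.refresh (m + 1)) t (0 + 1)) (datumLp w₀ hw₀)
      rw [grid_zero ht0]
    | succ j =>
      show Um 0 (grid (E.refresh (m + 1)) t (j + 1 + 1)) (datumLp w₀ hw₀) =
        Um (grid (E.refresh (m + 1)) t (j + 1)) (grid (E.refresh (m + 1)) t (j + 1 + 1)) (Um 0 (grid (E.refresh (m + 1)) t (j + 1)) (datumLp w₀ hw₀))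
      rw [hUm.comp 0 _ _ le_rfl (grid_nonneg hr.le ht0 _) (grid_mono hr.le t _) ((grid_le _ _ _).trans ht1)]
  have hL := window_ledger_abs
    (fun j => Um (grid (E.refresh (m + 1)) t j) (grid (E.refresh (m + 1)) t (j + 1)))
    (fun j x => hUm.norm_le _ _ x)
    (uSeq Um1 (datumLp w₀ hw₀) (E.N (m + 1) / 2) (E.refresh (m + 1)) t)
    (vSeq Um (datumLp w₀ hw₀) (E.refresh (m + 1)) t) e g (fun j => ‖g j‖) (Cη * ρ ^ ση) hη0 hη8 (fun j => norm_nonneg _)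
    rfl hvs hdec (fun j => le_rfl) hDD
    (⌊t / E.refresh (m + 1)⌋₊ + 1)
  have hsumG : ∑ j ∈ Finset.range (⌊t / E.refresh (m + 1)⌋₊ + 1), ‖g j‖ ≤ G := hGsum _
  have hsum0 : 0 ≤ ∑ j ∈ Finset.range (⌊t / E.refresh (m + 1)⌋₊ + 1), ‖g j‖ := Finset.sum_nonneg fun j _ => norm_nonneg _
  -- read the ledger at `K = ⌊t/refresh⌋₊ + 1`, where `grid K = t`
  have hKt : grid (E.refresh (m + 1)) t (⌊t / E.refresh (m + 1)⌋₊ + 1) = t := grid_floor_succ hr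
  have huK : uSeq Um1 (datumLp w₀ hw₀) (E.N (m + 1) / 2) (E.refresh (m + 1)) t (⌊t / E.refresh (m + 1)⌋₊ + 1) =
      cutLp (E.N (m + 1) / 2) (Um1 0 t (datumLp w₀ hw₀)) := by
    show cutLp (E.N (m + 1) / 2) (Um1 0 (grid (E.refresh (m + 1)) t (⌊t / E.refresh (m + 1)⌋₊ + 1)) (datumLp w₀ hw₀)) = _
    rw [hKt]
  have hvK : vSeq Um (datumLp w₀ hw₀) (E.refresh (m + 1)) t (⌊t / E.refresh (m + 1)⌋₊ + 1) = Um 0 t (datumLp w₀ hw₀) := by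
    show Um 0 (grid (E.refresh (m + 1)) t (⌊t / E.refresh (m + 1)⌋₊ + 1)) (datumLp w₀ hw₀) = _
    rw [hKt]
  have hv0 : vSeq Um (datumLp w₀ hw₀) (E.refresh (m + 1)) t 0 = datumLp w₀ hw₀ := rfl
  rw [huK, hvK, hv0] at hL
  -- arithmetic
  set D : ℝ := ‖datumLp w₀ hw₀‖ ^ 2 - ‖Um 0 t (datumLp w₀ hw₀)‖ ^ 2 with hD_def
  have hvle : ‖Um 0 t (datumLp w₀ hw₀)‖ ≤ ‖datumLp w₀ hw₀‖ := hUm.norm_le _ _ _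
  have hD0 : 0 ≤ D := by
    rw [hD_def]; exact sub_nonneg.2 (pow_le_pow_left₀ (norm_nonneg _) hvle 2)
  have hGG : G * G ≤ ‖datumLp w₀ hw₀‖ * G := mul_le_mul_of_nonneg_right hGle hG0
  have hjunk : 6 * (‖datumLp w₀ hw₀‖ + ∑ j ∈ Finset.range (⌊t / E.refresh (m + 1)⌋₊ + 1), ‖g j‖) *
      ∑ j ∈ Finset.range (⌊t / E.refresh (m + 1)⌋₊ + 1), ‖g j‖ ≤ 12 * (Cg * ρ ^ σg * D) := by
    calc 6 * (‖datumLp w₀ hw₀‖ + ∑ j ∈ Finset.range (⌊t / E.refresh (m + 1)⌋₊ + 1), ‖g j‖) *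
          ∑ j ∈ Finset.range (⌊t / E.refresh (m + 1)⌋₊ + 1), ‖g j‖
        ≤ 6 * ((‖datumLp w₀ hw₀‖ + G) * G) := by
          rw [mul_assoc]
          exact mul_le_mul_of_nonneg_left (mul_le_mul (by linarith [hsumG]) hsumG hsum0 (by positivity)) (by norm_num)
      _ = 6 * (‖datumLp w₀ hw₀‖ * G) + 6 * (G * G) := by ring
      _ ≤ 6 * (‖datumLp w₀ hw₀‖ * G) + 6 * (‖datumLp w₀ hw₀‖ * G) := by linarith [hGG]
      _ = 12 * (‖datumLp w₀ hw₀‖ * G) := by ring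
      _ ≤ 12 * (Cg * ρ ^ σg * D) := by linarith [hGpay]
  have hρpow : ∀ {s : ℝ}, min ση (min σg σφ) ≤ s → ρ ^ s ≤ ρ ^ min ση (min σg σφ) := fun hs =>
    Real.rpow_le_rpow_of_exponent_ge' hρ0 hρ1 (lt_min hση (lt_min hσg hσφ)).le hs
  have h1 := mul_le_mul_of_nonneg_left (hρpow (min_le_left ση (min σg σφ))) hCη.le
  have h2 := mul_le_mul_of_nonneg_left (hρpow ((min_le_right ση (min σg σφ)).trans (min_le_left σg σφ))) hCg.le
  have h3 := mul_le_mul_of_nonneg_left (hρpow ((min_le_right ση (min σg σφ)).trans (min_le_right σg σφ))) hCφ.le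
  have hX : 3 * (Cη * ρ ^ ση) + 12 * (Cg * ρ ^ σg) + Cφ * ρ ^ σφ ≤ (3 * Cη + 12 * Cg + Cφ) * ρ ^ min ση (min σg σφ) := by
    linarith [h1, h2, h3]
  have hmain : ‖Um1 0 t (datumLp w₀ hw₀)‖ ^ 2 ≤ ‖Um 0 t (datumLp w₀ hw₀)‖ ^ 2 +
      (3 * (Cη * ρ ^ ση) + 12 * (Cg * ρ ^ σg) + Cφ * ρ ^ σφ) * D := by
    linarith [hL, hfast, hjunk]
  have hXD := mul_le_mul_of_nonneg_right hX hD0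
  simp only [drop]
  rw [hEu, hEv, hE0, ← hD_def]
  linarith [hmain, hXD, hD_def]

end

end Summit.AnomalousDissipation.AnomalousDissipation.Theorems.SolenoidalFractalHomogenisation.LagrangianStep
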